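import Summits.CriticalPhenomena.PercolationContinuityZ3.Theorems.PercTiltedBlockersCubeBlockingSeedOfHeightHalvingAll
import HarnessLib

/-!
# Crux `CubeBlockingSeed` (stmt-CriticalPhenomena-1141), line `registered` — the bounded-aspect height halving
# `HeightHalving12` (CORRECTION of `…CubeBlockingSeedOfHeightHalvingAll.lean`), importable

Helper file of the line lead c1 (`--supports stmt-CriticalPhenomena-1141`, registered sub-goal
`stub_cruxOfFlatAnnulusCrossingOfHeightHalving12`).

## Why a correction

The hypothesis `HeightHalvingAll` of `…CubeBlockingSeedOfHeightHalvingAll.lean` (p154200) quantifies over ALL boxes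
`h, L, M ≥ 1`, and that is too much: it fails in the regime of THIN, very LONG walls (`L` fixed, `h → ∞`,
`M = M(h) → ∞` super-exponentially), so the theorems there, while correct, are expected to be VACUOUS. The mechanism
(rigorous modulo standard facts — strict subcriticality of the two-layer slab `ℤ² × {0,1}` at `p_c(ℤ³)`
(Aizenman–Grimmett) and sharpness of the subcritical phase on that slab): in the wall `[0,H] × [0,1] × [0,M]` a
bottom–top crossing at a given location is a rare event of probability `u_H = e^{-H/ξ(1+o(1))}` (`ξ` = correlation
length of the two-layer slab at `p_c(ℤ³)`), crossings in disjoint sub-walls of bounded width are independent, and a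
union bound over the `2(M+1)` bottom vertices controls the other direction; hence `β(H; 1, M) ≤ exp(-c M u_H)` and
`β(H; 1, M) ≥ 1 - 2(M+1) û_H` with `û_{2h} ≤ C h e^{-2h/ξ} ≪ u_h`. Choosing `M(h) ≍ 1/(8 û_{2h})` gives
`β(2h; 1, M(h)) ≥ 1/2` while `β(h; 1, M(h)) ≤ exp(-c u_h / (8 û_{2h})) → 0`, contradicting `g(1/2) ≤ β(h; 1, M(h))`
for any admissible `g`. (Poisson statistics of MANY independent RARE trials: halving the height takes a square root
of the per-trial probability, and the number of trials can be tuned in between.) The mechanism needs the number of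
independent trial locations to exceed `1/u_h`, which is impossible once the cross-section is bounded by a multiple of
the height: for `L, M ≤ A·h` the exponent `(M/ξ_L)·u_h ≤ A (h/ξ_L) e^{-h/ξ_L} ≤ A/e` stays bounded. All instances
the route consumes are of bounded aspect: the halving rung uses `L = M = n ≤ h = kn`, the flat height halving of the
6393 lead uses `h = 2m`, `L, M ≤ 24m = 12h`. Hence the corrected single comparison statement:

`HeightHalving12` :≡ `∃ g mono, g > 0 on (0,∞), ∀ h L M ≥ 1, L ≤ 12h → M ≤ 12h →
g (P_{p_c}(Blocked R(2h; L, M))) ≤ P_{p_c}(Blocked R(h; L, M))`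

(bounded-aspect fixed-factor RSW in the hard direction; believed OPEN, Benjamini–Kalai 2018 p.71; consistent with
every regime checked: fat/scaling boxes — the genuine content; tall thin tubes and thin walls of aspect ≤ 12 — both
sides near 1 or bounded below outright; flat plates of aspect ≤ 12 — bounded below given any seed; `d > 6` — both
sides small). The theorems below re-derive everything of p154200 from `HeightHalving12`; they are the ones to use:

* `halvingRung_of_heightHalving12` — the halving rung `∀ k ≥ 1, SeedAt (2k) → SeedAt k`;
* `cubeBlockingSeed_of_tallSeed_of_heightHalving12` — `TubeSeed ∧ HeightHalving12 ⟹ CubeBlockingSeed`;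
* `stub_cruxOfFlatAnnulusCrossingOfHeightHalving12`, `cubeBlockingSeed(_|')_of_flatAnnulusCrossing_of_heightHalving12`
  — `FlatAnnulusCrossing (6699) ∧ HeightHalving12 ⟹ CubeBlockingSeed (1141)` (both route decls);
* `heightHalvingFlat_of_heightHalving12`, `tiltComparison_of_heightHalving12` — `HeightHalving12 ⟹ HH_flat ⟹
  TiltComparison (6393)`;
* `percolationContinuityZ3_of_flatAnnulusCrossing_of_heightHalving12` — **`6699 ∧ HeightHalving12 ⟹ θ(p_c) = 0 on ℤ³`**
  via the route's deciding theorem `Theses.PercTiltedBlockers.closes`.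

No definitions; no unproved facts (every open statement is a hypothesis written out in tree vocabulary).

## References
* I. Benjamini, G. Kalai (2018) p.71, doi:10.2140/memocs.2018.6.69 ('RSW for plaquettes in cubes', open) [BenjaminiKalai2018].
* M. Aizenman, G. Grimmett, J. Stat. Phys. 63 (1991) 817–835 (strict inequalities for critical points) [AizenmanGrimmett1991].
* G. Grimmett, *Percolation*, 2nd ed. (1999), §5–§6 (subcritical sharpness, correlation length) [Grimmett1999].
-/

noncomputable section

namespace Summit.CriticalPhenomena.PercolationContinuityZ3.Theorems.CubeBlockingSeed

open MeasureTheory Literature.Probability.Percolation Literature.Probability.LatticeModels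
open Summit.CriticalPhenomena.PercolationContinuityZ3.Theses

/-- **The halving rung from bounded-aspect height halving**: `HeightHalving12 → ∀ k ≥ 1, SeedAt (2k) → SeedAt k`
(registered text of the line's `stub_halvingRung`): instance `h = kn ≥ n = L = M`. [folklore] -/
theorem halvingRung_of_heightHalving12
    (hHH : ∃ g : ℝ → ℝ, Monotone g ∧ (∀ s, 0 < s → 0 < g s) ∧ ∀ h L M : ℕ, 1 ≤ h → 1 ≤ L → 1 ≤ M →
      L ≤ 12 * h → M ≤ 12 * h →
      g ((bondPercolation (zdGraph 3) (criticalProbI 3)).real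
          {ω | ¬ ∃ x ∈ Finset.Icc (0 : Site 3) ![((2 * h : ℕ) : ℤ), L, M],
            ∃ y ∈ Finset.Icc (0 : Site 3) ![((2 * h : ℕ) : ℤ), L, M],
              x 0 = 0 ∧ y 0 = ((2 * h : ℕ) : ℤ) ∧
                ω ∈ openConnIn ↑(Finset.Icc (0 : Site 3) ![((2 * h : ℕ) : ℤ), L, M]) x y}) ≤
        (bondPercolation (zdGraph 3) (criticalProbI 3)).real
          {ω | ¬ ∃ x ∈ Finset.Icc (0 : Site 3) ![(h : ℤ), L, M],
            ∃ y ∈ Finset.Icc (0 : Site 3) ![(h : ℤ), L, M],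
              x 0 = 0 ∧ y 0 = (h : ℤ) ∧
                ω ∈ openConnIn ↑(Finset.Icc (0 : Site 3) ![(h : ℤ), L, M]) x y}) :
    ∀ k : ℕ, 1 ≤ k →
      (∃ c : ℝ, 0 < c ∧ ∀ n : ℕ, 1 ≤ n → c ≤ (bondPercolation (zdGraph 3) (criticalProbI 3)).real
        {ω | ¬ ∃ x ∈ Finset.Icc (0 : Site 3) ![((2 * k * n : ℕ) : ℤ), ((n : ℕ) : ℤ), ((n : ℕ) : ℤ)],
          ∃ y ∈ Finset.Icc (0 : Site 3) ![((2 * k * n : ℕ) : ℤ), ((n : ℕ) : ℤ), ((n : ℕ) : ℤ)],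
            x 0 = 0 ∧ y 0 = ((2 * k * n : ℕ) : ℤ) ∧
              ω ∈ openConnIn ↑(Finset.Icc (0 : Site 3) ![((2 * k * n : ℕ) : ℤ), ((n : ℕ) : ℤ), ((n : ℕ) : ℤ)]) x y}) →
      (∃ c : ℝ, 0 < c ∧ ∀ n : ℕ, 1 ≤ n → c ≤ (bondPercolation (zdGraph 3) (criticalProbI 3)).real
        {ω | ¬ ∃ x ∈ Finset.Icc (0 : Site 3) ![((k * n : ℕ) : ℤ), ((n : ℕ) : ℤ), ((n : ℕ) : ℤ)],
          ∃ y ∈ Finset.Icc (0 : Site 3) ![((k * n : ℕ) : ℤ), ((n : ℕ) : ℤ), ((n : ℕ) : ℤ)],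
            x 0 = 0 ∧ y 0 = ((k * n : ℕ) : ℤ) ∧
              ω ∈ openConnIn ↑(Finset.Icc (0 : Site 3) ![((k * n : ℕ) : ℤ), ((n : ℕ) : ℤ), ((n : ℕ) : ℤ)]) x y}) := by
  intro k hk h2k
  obtain ⟨g, hgm, hgp, hg⟩ := hHH
  obtain ⟨c, hc, hcle⟩ := h2k
  refine ⟨g c, hgp c hc, fun n hn => ?_⟩
  have hkn : 1 ≤ k * n := Nat.one_le_iff_ne_zero.2 (Nat.mul_ne_zero (by omega) (by omega))
  have hnk : n ≤ 12 * (k * n) := by nlinarith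
  have step := hg (k * n) n n hkn hn hn hnk hnk
  have e : 2 * (k * n) = 2 * k * n := (Nat.mul_assoc 2 k n).symm
  rw [e] at step
  exact (hgm (hcle n hn)).trans step

/-- **Tube seed + bounded-aspect height halving ⟹ the crux** (`Theses.PercTiltedBlockers.CubeBlockingSeed` by name).
[folklore] -/
theorem cubeBlockingSeed_of_tallSeed_of_heightHalving12
    (hT : ∃ k : ℕ, 1 ≤ k ∧ (∃ c : ℝ, 0 < c ∧ ∀ n : ℕ, 1 ≤ n → c ≤ (bondPercolation (zdGraph 3) (criticalProbI 3)).real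
        {ω | ¬ ∃ x ∈ Finset.Icc (0 : Site 3) ![((k * n : ℕ) : ℤ), ((n : ℕ) : ℤ), ((n : ℕ) : ℤ)],
          ∃ y ∈ Finset.Icc (0 : Site 3) ![((k * n : ℕ) : ℤ), ((n : ℕ) : ℤ), ((n : ℕ) : ℤ)],
            x 0 = 0 ∧ y 0 = ((k * n : ℕ) : ℤ) ∧
              ω ∈ openConnIn ↑(Finset.Icc (0 : Site 3) ![((k * n : ℕ) : ℤ), ((n : ℕ) : ℤ), ((n : ℕ) : ℤ)]) x y}))
    (hHH : ∃ g : ℝ → ℝ, Monotone g ∧ (∀ s, 0 < s → 0 < g s) ∧ ∀ h L M : ℕ, 1 ≤ h → 1 ≤ L → 1 ≤ M →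
      L ≤ 12 * h → M ≤ 12 * h →
      g ((bondPercolation (zdGraph 3) (criticalProbI 3)).real
          {ω | ¬ ∃ x ∈ Finset.Icc (0 : Site 3) ![((2 * h : ℕ) : ℤ), L, M],
            ∃ y ∈ Finset.Icc (0 : Site 3) ![((2 * h : ℕ) : ℤ), L, M],
              x 0 = 0 ∧ y 0 = ((2 * h : ℕ) : ℤ) ∧
                ω ∈ openConnIn ↑(Finset.Icc (0 : Site 3) ![((2 * h : ℕ) : ℤ), L, M]) x y}) ≤
        (bondPercolation (zdGraph 3) (criticalProbI 3)).real
          {ω | ¬ ∃ x ∈ Finset.Icc (0 : Site 3) ![(h : ℤ), L, M],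
            ∃ y ∈ Finset.Icc (0 : Site 3) ![(h : ℤ), L, M],
              x 0 = 0 ∧ y 0 = (h : ℤ) ∧
                ω ∈ openConnIn ↑(Finset.Icc (0 : Site 3) ![(h : ℤ), L, M]) x y}) :
    PercTiltedBlockers.CubeBlockingSeed :=
  cubeBlockingSeed_of_tallSeed_of_halvingRung hT (halvingRung_of_heightHalving12 hHH)

/-- **`stub_cruxOfFlatAnnulusCrossingOfHeightHalving12`** (registered sub-goal of crux stmt-CriticalPhenomena-1141; the one
to use): `FlatAnnulusCrossing` (stmt-6699) and the bounded-aspect height halving `HeightHalving12` imply the crux's body —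
tube seed from 6699 (`stub_tallSeedOfFlatAnnulusCrossing`), halving rungs from `halvingRung_of_heightHalving12`, ladder
(`stub_ladder`). [folklore] -/
theorem stub_cruxOfFlatAnnulusCrossingOfHeightHalving12 :
    PercDivergentSlabLadder.FlatAnnulusCrossing →
      (∃ g : ℝ → ℝ, Monotone g ∧ (∀ s, 0 < s → 0 < g s) ∧ ∀ h L M : ℕ, 1 ≤ h → 1 ≤ L → 1 ≤ M →
        L ≤ 12 * h → M ≤ 12 * h →
        g ((bondPercolation (zdGraph 3) (criticalProbI 3)).real
            {ω | ¬ ∃ x ∈ Finset.Icc (0 : Site 3) ![((2 * h : ℕ) : ℤ), L, M],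
              ∃ y ∈ Finset.Icc (0 : Site 3) ![((2 * h : ℕ) : ℤ), L, M],
                x 0 = 0 ∧ y 0 = ((2 * h : ℕ) : ℤ) ∧
                  ω ∈ openConnIn ↑(Finset.Icc (0 : Site 3) ![((2 * h : ℕ) : ℤ), L, M]) x y}) ≤
          (bondPercolation (zdGraph 3) (criticalProbI 3)).real
            {ω | ¬ ∃ x ∈ Finset.Icc (0 : Site 3) ![(h : ℤ), L, M],
              ∃ y ∈ Finset.Icc (0 : Site 3) ![(h : ℤ), L, M],
                x 0 = 0 ∧ y 0 = (h : ℤ) ∧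
                  ω ∈ openConnIn ↑(Finset.Icc (0 : Site 3) ![(h : ℤ), L, M]) x y}) →
      ∃ c : ℝ, 0 < c ∧ ∀ n : ℕ, 1 ≤ n → c ≤ (bondPercolation (zdGraph 3) (criticalProbI 3)).real
        {ω | ¬ ∃ x ∈ Finset.Icc (0 : Site 3) ![(n : ℤ), n, n], ∃ y ∈ Finset.Icc (0 : Site 3) ![(n : ℤ), n, n],
          x 0 = 0 ∧ y 0 = n ∧ ω ∈ openConnIn ↑(Finset.Icc (0 : Site 3) ![(n : ℤ), n, n]) x y} :=
  fun h6699 hHH => stub_ladder (stub_tallSeedOfFlatAnnulusCrossing h6699) (halvingRung_of_heightHalving12 hHH)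

/-- `FlatAnnulusCrossing (6699) ∧ HeightHalving12 ⟹ CubeBlockingSeed`, concluding the item's primary decl
`Theses.PercAnnulusCrossing.CubeBlockingSeed` by name. [folklore] -/
theorem cubeBlockingSeed_of_flatAnnulusCrossing_of_heightHalving12
    (h6699 : PercDivergentSlabLadder.FlatAnnulusCrossing)
    (hHH : ∃ g : ℝ → ℝ, Monotone g ∧ (∀ s, 0 < s → 0 < g s) ∧ ∀ h L M : ℕ, 1 ≤ h → 1 ≤ L → 1 ≤ M →
      L ≤ 12 * h → M ≤ 12 * h →
      g ((bondPercolation (zdGraph 3) (criticalProbI 3)).real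
          {ω | ¬ ∃ x ∈ Finset.Icc (0 : Site 3) ![((2 * h : ℕ) : ℤ), L, M],
            ∃ y ∈ Finset.Icc (0 : Site 3) ![((2 * h : ℕ) : ℤ), L, M],
              x 0 = 0 ∧ y 0 = ((2 * h : ℕ) : ℤ) ∧
                ω ∈ openConnIn ↑(Finset.Icc (0 : Site 3) ![((2 * h : ℕ) : ℤ), L, M]) x y}) ≤
        (bondPercolation (zdGraph 3) (criticalProbI 3)).real
          {ω | ¬ ∃ x ∈ Finset.Icc (0 : Site 3) ![(h : ℤ), L, M],
            ∃ y ∈ Finset.Icc (0 : Site 3) ![(h : ℤ), L, M],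
              x 0 = 0 ∧ y 0 = (h : ℤ) ∧
                ω ∈ openConnIn ↑(Finset.Icc (0 : Site 3) ![(h : ℤ), L, M]) x y}) :
    PercAnnulusCrossing.CubeBlockingSeed :=
  stub_cruxOfFlatAnnulusCrossingOfHeightHalving12 h6699 hHH

/-- The same for the verbatim twin `Theses.PercTiltedBlockers.CubeBlockingSeed`. [folklore] -/
theorem cubeBlockingSeed'_of_flatAnnulusCrossing_of_heightHalving12
    (h6699 : PercDivergentSlabLadder.FlatAnnulusCrossing)
    (hHH : ∃ g : ℝ → ℝ, Monotone g ∧ (∀ s, 0 < s → 0 < g s) ∧ ∀ h L M : ℕ, 1 ≤ h → 1 ≤ L → 1 ≤ M →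
      L ≤ 12 * h → M ≤ 12 * h →
      g ((bondPercolation (zdGraph 3) (criticalProbI 3)).real
          {ω | ¬ ∃ x ∈ Finset.Icc (0 : Site 3) ![((2 * h : ℕ) : ℤ), L, M],
            ∃ y ∈ Finset.Icc (0 : Site 3) ![((2 * h : ℕ) : ℤ), L, M],
              x 0 = 0 ∧ y 0 = ((2 * h : ℕ) : ℤ) ∧
                ω ∈ openConnIn ↑(Finset.Icc (0 : Site 3) ![((2 * h : ℕ) : ℤ), L, M]) x y}) ≤
        (bondPercolation (zdGraph 3) (criticalProbI 3)).real
          {ω | ¬ ∃ x ∈ Finset.Icc (0 : Site 3) ![(h : ℤ), L, M],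
            ∃ y ∈ Finset.Icc (0 : Site 3) ![(h : ℤ), L, M],
              x 0 = 0 ∧ y 0 = (h : ℤ) ∧
                ω ∈ openConnIn ↑(Finset.Icc (0 : Site 3) ![(h : ℤ), L, M]) x y}) :
    PercTiltedBlockers.CubeBlockingSeed :=
  stub_cruxOfFlatAnnulusCrossingOfHeightHalving12 h6699 hHH

/-- **Bounded-aspect height halving gives the flat-family `HH`** of the 6393 lead (hypothesis of
`TiltComparison.tiltComparison_of_heightHalving`, verbatim): instance `h = 2m`, `L, M ≤ 24m = 12h`. [folklore] -/
theorem heightHalvingFlat_of_heightHalving12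
    (hHH : ∃ g : ℝ → ℝ, Monotone g ∧ (∀ s, 0 < s → 0 < g s) ∧ ∀ h L M : ℕ, 1 ≤ h → 1 ≤ L → 1 ≤ M →
      L ≤ 12 * h → M ≤ 12 * h →
      g ((bondPercolation (zdGraph 3) (criticalProbI 3)).real
          {ω | ¬ ∃ x ∈ Finset.Icc (0 : Site 3) ![((2 * h : ℕ) : ℤ), L, M],
            ∃ y ∈ Finset.Icc (0 : Site 3) ![((2 * h : ℕ) : ℤ), L, M],
              x 0 = 0 ∧ y 0 = ((2 * h : ℕ) : ℤ) ∧
                ω ∈ openConnIn ↑(Finset.Icc (0 : Site 3) ![((2 * h : ℕ) : ℤ), L, M]) x y}) ≤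
        (bondPercolation (zdGraph 3) (criticalProbI 3)).real
          {ω | ¬ ∃ x ∈ Finset.Icc (0 : Site 3) ![(h : ℤ), L, M],
            ∃ y ∈ Finset.Icc (0 : Site 3) ![(h : ℤ), L, M],
              x 0 = 0 ∧ y 0 = (h : ℤ) ∧
                ω ∈ openConnIn ↑(Finset.Icc (0 : Site 3) ![(h : ℤ), L, M]) x y}) :
    ∃ g : ℝ → ℝ, Monotone g ∧ (∀ s, 0 < s → 0 < g s) ∧ ∀ m L M : ℕ, 1 ≤ m → 4 * m ≤ L →
      L ≤ 24 * m → 4 * m ≤ M → M ≤ 24 * m →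
        g ((bondPercolation (zdGraph 3) (criticalProbI 3)).real
            {ω | ¬ ∃ x ∈ Finset.Icc (0 : Site 3) ![4 * (m : ℤ), L, M],
              ∃ y ∈ Finset.Icc (0 : Site 3) ![4 * (m : ℤ), L, M],
                x 0 = 0 ∧ y 0 = 4 * m ∧
                  ω ∈ openConnIn ↑(Finset.Icc (0 : Site 3) ![4 * (m : ℤ), L, M]) x y}) ≤
          (bondPercolation (zdGraph 3) (criticalProbI 3)).real
            {ω | ¬ ∃ x ∈ Finset.Icc (0 : Site 3) ![2 * (m : ℤ), L, M],
              ∃ y ∈ Finset.Icc (0 : Site 3) ![2 * (m : ℤ), L, M],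
                x 0 = 0 ∧ y 0 = 2 * m ∧
                  ω ∈ openConnIn ↑(Finset.Icc (0 : Site 3) ![2 * (m : ℤ), L, M]) x y} := by
  obtain ⟨g, hgm, hgp, hg⟩ := hHH
  refine ⟨g, hgm, hgp, fun m L M hm hL hL' hM hM' => ?_⟩
  have step := hg (2 * m) L M (by omega) (by omega) (by omega) (by omega) (by omega)
  have e1 : ((2 * (2 * m) : ℕ) : ℤ) = 4 * (m : ℤ) := by push_cast; ring
  have e2 : ((2 * m : ℕ) : ℤ) = 2 * (m : ℤ) := by push_cast; ring
  simp only [e1, e2] at step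
  exact step

/-- **Bounded-aspect height halving gives the sibling crux `TiltComparison`** (stmt-CriticalPhenomena-6393, by name), via the
6393 lead's `TiltComparison.tiltComparison_of_heightHalving` (p151087). [folklore] -/
theorem tiltComparison_of_heightHalving12
    (hHH : ∃ g : ℝ → ℝ, Monotone g ∧ (∀ s, 0 < s → 0 < g s) ∧ ∀ h L M : ℕ, 1 ≤ h → 1 ≤ L → 1 ≤ M →
      L ≤ 12 * h → M ≤ 12 * h →
      g ((bondPercolation (zdGraph 3) (criticalProbI 3)).real
          {ω | ¬ ∃ x ∈ Finset.Icc (0 : Site 3) ![((2 * h : ℕ) : ℤ), L, M],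
            ∃ y ∈ Finset.Icc (0 : Site 3) ![((2 * h : ℕ) : ℤ), L, M],
              x 0 = 0 ∧ y 0 = ((2 * h : ℕ) : ℤ) ∧
                ω ∈ openConnIn ↑(Finset.Icc (0 : Site 3) ![((2 * h : ℕ) : ℤ), L, M]) x y}) ≤
        (bondPercolation (zdGraph 3) (criticalProbI 3)).real
          {ω | ¬ ∃ x ∈ Finset.Icc (0 : Site 3) ![(h : ℤ), L, M],
            ∃ y ∈ Finset.Icc (0 : Site 3) ![(h : ℤ), L, M],
              x 0 = 0 ∧ y 0 = (h : ℤ) ∧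
                ω ∈ openConnIn ↑(Finset.Icc (0 : Site 3) ![(h : ℤ), L, M]) x y}) :
    PercTiltedBlockers.TiltComparison :=
  TiltComparison.tiltComparison_of_heightHalving (heightHalvingFlat_of_heightHalving12 hHH)

/-- **`FlatAnnulusCrossing ∧ HeightHalving12 ⟹ θ(p_c) = 0 on ℤ³`** (the corrected headline; conditional on two open
statements): the route's deciding theorem `Theses.PercTiltedBlockers.closes` needs `TiltComparison`
(`tiltComparison_of_heightHalving12`) and `CubeBlockingSeed` (`cubeBlockingSeed'_of_flatAnnulusCrossing_of_heightHalving12`).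
[folklore] -/
theorem percolationContinuityZ3_of_flatAnnulusCrossing_of_heightHalving12
    (h6699 : PercDivergentSlabLadder.FlatAnnulusCrossing)
    (hHH : ∃ g : ℝ → ℝ, Monotone g ∧ (∀ s, 0 < s → 0 < g s) ∧ ∀ h L M : ℕ, 1 ≤ h → 1 ≤ L → 1 ≤ M →
      L ≤ 12 * h → M ≤ 12 * h →
      g ((bondPercolation (zdGraph 3) (criticalProbI 3)).real
          {ω | ¬ ∃ x ∈ Finset.Icc (0 : Site 3) ![((2 * h : ℕ) : ℤ), L, M],
            ∃ y ∈ Finset.Icc (0 : Site 3) ![((2 * h : ℕ) : ℤ), L, M],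
              x 0 = 0 ∧ y 0 = ((2 * h : ℕ) : ℤ) ∧
                ω ∈ openConnIn ↑(Finset.Icc (0 : Site 3) ![((2 * h : ℕ) : ℤ), L, M]) x y}) ≤
        (bondPercolation (zdGraph 3) (criticalProbI 3)).real
          {ω | ¬ ∃ x ∈ Finset.Icc (0 : Site 3) ![(h : ℤ), L, M],
            ∃ y ∈ Finset.Icc (0 : Site 3) ![(h : ℤ), L, M],
              x 0 = 0 ∧ y 0 = (h : ℤ) ∧
                ω ∈ openConnIn ↑(Finset.Icc (0 : Site 3) ![(h : ℤ), L, M]) x y}) :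
    _root_.PercolationContinuityZ3 :=
  PercTiltedBlockers.closes (tiltComparison_of_heightHalving12 hHH)
    (cubeBlockingSeed'_of_flatAnnulusCrossing_of_heightHalving12 h6699 hHH)

end Summit.CriticalPhenomena.PercolationContinuityZ3.Theorems.CubeBlockingSeed

end
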